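/-
Copyright (c) 2026 the pub-hodgecm-mathlib formalisation cell (harness21).  Prover seat hodgecm-mathlib-F0P3a-p01 (g35), Track A «(D-RAM) FOUR-FRAME» helper lane
(`--supports stmt-HodgeConjecture-24833 --as helper`); STAGE-1b count-neutral brick «(L-lev-0) AT EVEN `d` IS FREE» (dealer LH4-plan (g12) WORD #42 (L-lev)-SIG, target (T3),
even half).  2026-09-04.
-/
import Summits.HodgeConjecture.HodgeConjecture.Theorems.F0P3cDyRamFourFrameCensusDefs   -- ★ census DEFS `LatticeInLevel` (brings ★ `mapGL`, `scaleLattice`, `mem_scaleLattice_iff`, `IsVertexLattice`)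
import HarnessLib

/-!
# Crux `H413`, line LH4 «(D-RAM) FOUR-FRAME» — STAGE-1b brick: the LOWER two-level census at first level `0` IS the square-level census

Cell `hodgecm-mathlib` (D-0151), FLOOR 0, crux item H413 = `stmt-HodgeConjecture-24833`, route of record `HCCMUnconditional`; squad F0∕P3c∕LH4 ∕ F0∕P3a; helper lane
(count-neutral).  THEOREMS ONLY (no `def`, no instance, no notation, no `sorry`, default heartbeats).  Consumer: the STAGE-1b (L-lev) producer (signature sheet
`F0/P3a/F0P3a-p01/g35/laws/SIG-L-lev.v2.F0P3ap01g35.md`, target (T3) `dyadicFence_levLowEqSqAt_ofRecord`): at a place with EVEN different-exponent datum `d`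
(`ℓ₀ = d % 2 = 0` — every R-U cell) the lower shell-half piece `𝟙_{K_{ℓ₀,m*}}` of F0P3a-p01 (g35)'s ★ `pieceRowsWild_shell_of_levels` (hypothesis `hA`) has the SAME fixed-vertex
census as LH4-p12 (g7)'s square-level piece `𝟙{u ∈ K ∣ X² ∈ ϖ^{m*}M₃}`, literal by literal and for EVERY `T` — because a vertex `M` fixed by `T` has `(T − 1)·M ⊆ M = ϖ^0·M`
for free.  So (T3) has content only at odd `d` (R-P cells), and at even `d` the lower-half census law is LH4-p12 (g7)'s (L-sq) law BY NAME.

* `latticeInLevel_zero_of_mapGL_eq` — `T·M = M ⇒ LatticeInLevel ϖ 0 (T − 1) M` (cf. ★ `map_sub_one_le_scaleLattice_pow_zero_of_latticeGraphIso_eq`, here for a bare `mapGL` fixed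
  point, no vertex structure needed);
* `setOf_levels_zero_eq_setOf_sqLevel`, `ncard_levels_zero_eq_ncard_sqLevel` — the two census set-builders of ★ `pieceCountDictionary_levels (a := 0) b` and
  ★ `pieceCountDictionary_sqLevel b` (Theorems/F0P3cDyRamLevelsPieceCountDictionary) coincide at every literal `T`, hence so do their counts (`Set.ncard`), any `ϖ`, any `b`.
HONEST LABEL.  Count-neutral (`--supports`): no tier-0 row is paid here; `HC_CM` is proved only modulo the 7 printed citations (2 remaining named inputs: hLiu418 =
`stmt-HodgeConjecture-24832`, h413 = `stmt-HodgeConjecture-24833`) until rung 0 closes.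
-/

set_option autoImplicit false

namespace Summit.HodgeConjecture.HodgeConjecture.Cruxes.H413.F0P3cDyRamLevelsZeroEqSqLevel

open scoped Valued WithZero Matrix MatrixGroups
open Literature.NumberTheory.Automorphic Literature.NumberTheory.Automorphic.HermitianLattice
  Literature.NumberTheory.Automorphic.UnitaryLatticeTree
open Summit.HodgeConjecture.HodgeConjecture.Cruxes.H413.F0P3cDyRamFourFrameCensusDefs

variable {K : Type} [Field K] [Valued K ℤᵐ⁰]

/-- **A `T`-FIXED LATTICE IS AT LEVEL `0` FOR `T − 1`**: `T·M = M ⇒ (T − 1)·M ⊆ ϖ^0·M = M` (`(T − 1)x = Tx − x`, both in `M`).  No vertex ∕ self-duality hypothesis.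
[cite: Kottwitz1986BaseChangeUnits, §1 pp. 240–241] [cite: Serre1980Trees, II.1.1] -/
theorem latticeInLevel_zero_of_mapGL_eq (ϖ : K) (T : GL (Fin 3) K) {M : Submodule 𝒪[K] (Fin 3 → K)} (hfix : mapGL T M = M) :
    LatticeInLevel ϖ 0 ((T : Matrix (Fin 3) (Fin 3) K) - 1) M := by
  rintro _ ⟨x, hx, rfl⟩
  rw [pow_zero, mem_scaleLattice_iff one_ne_zero, inv_one, one_smul, LinearMap.restrictScalars_apply, Matrix.toLin'_apply, Matrix.sub_mulVec,
    Matrix.one_mulVec]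
  refine M.sub_mem ?_ hx
  have hmem : (T : Matrix (Fin 3) (Fin 3) K) *ᵥ x ∈ mapGL T M :=
    Submodule.mem_map_of_mem (f := (Matrix.toLin' (T : Matrix (Fin 3) (Fin 3) K)).restrictScalars 𝒪[K]) hx
  rwa [hfix] at hmem

/-- **THE TWO-LEVEL CENSUS SET AT FIRST LEVEL `0` IS THE SQUARE-LEVEL CENSUS SET**, at every literal `T`, every `ϖ`, every square level `b`:
`{M type-0 ∣ T·M = M ∧ ((T−1)·M ⊆ ϖ^0 M ∧ (T−1)²·M ⊆ ϖ^b M)} = {M type-0 ∣ T·M = M ∧ (T−1)²·M ⊆ ϖ^b M}` (set-builders = ★ `pieceCountDictionary_levels` ∕ `_sqLevel`'s,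
token for token). [cite: Kottwitz1986BaseChangeUnits, §1 pp. 240–241] [cite: Rogawski1990, §4.9 Prop. 4.9.1 (b) p. 55] -/
theorem setOf_levels_zero_eq_setOf_sqLevel (σ : K →+* K) (ϖ : K) (b : ℕ) (T : GL (Fin 3) K) :
    {M : Submodule 𝒪[K] (Fin 3 → K) | IsVertexLattice σ ϖ ((StdForm.antidiagonal 3).over K) 0 M ∧ mapGL T M = M ∧
        (LatticeInLevel ϖ 0 ((T : Matrix (Fin 3) (Fin 3) K) - 1) M ∧
          LatticeInLevel ϖ b (((T : Matrix (Fin 3) (Fin 3) K) - 1) * ((T : Matrix (Fin 3) (Fin 3) K) - 1)) M)} =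
      {M : Submodule 𝒪[K] (Fin 3 → K) | IsVertexLattice σ ϖ ((StdForm.antidiagonal 3).over K) 0 M ∧ mapGL T M = M ∧
        LatticeInLevel ϖ b (((T : Matrix (Fin 3) (Fin 3) K) - 1) * ((T : Matrix (Fin 3) (Fin 3) K) - 1)) M} := by
  ext M
  simp only [Set.mem_setOf_eq]
  constructor
  · rintro ⟨h0, hT, -, hb⟩
    exact ⟨h0, hT, hb⟩
  · rintro ⟨h0, hT, hb⟩
    exact ⟨h0, hT, latticeInLevel_zero_of_mapGL_eq ϖ T hT, hb⟩

/-- **(L-lev-0) AT EVEN `d` IS FREE — THE COUNTS**: `#levels_{0,b}(T) = #sq_b(T)` at every literal `T` (finite or not: `Set.ncard` of equal sets).  At a place with `d % 2 = 0`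
this is target (T3) of the (L-lev) signature sheet literally (`ℓ₀ = 0`, `b = m*`), so the lower-half census law there is the square-level law by name.
[cite: Kottwitz1986BaseChangeUnits, §1 pp. 240–241] [cite: Rogawski1990, §4.9 Prop. 4.9.1 (b) p. 55] -/
theorem ncard_levels_zero_eq_ncard_sqLevel (σ : K →+* K) (ϖ : K) (b : ℕ) (T : GL (Fin 3) K) :
    {M : Submodule 𝒪[K] (Fin 3 → K) | IsVertexLattice σ ϖ ((StdForm.antidiagonal 3).over K) 0 M ∧ mapGL T M = M ∧
        (LatticeInLevel ϖ 0 ((T : Matrix (Fin 3) (Fin 3) K) - 1) M ∧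
          LatticeInLevel ϖ b (((T : Matrix (Fin 3) (Fin 3) K) - 1) * ((T : Matrix (Fin 3) (Fin 3) K) - 1)) M)}.ncard =
      {M : Submodule 𝒪[K] (Fin 3 → K) | IsVertexLattice σ ϖ ((StdForm.antidiagonal 3).over K) 0 M ∧ mapGL T M = M ∧
        LatticeInLevel ϖ b (((T : Matrix (Fin 3) (Fin 3) K) - 1) * ((T : Matrix (Fin 3) (Fin 3) K) - 1)) M}.ncard := by
  rw [setOf_levels_zero_eq_setOf_sqLevel σ ϖ b T]

/-- The same with the first level written `d % 2` under `d % 2 = 0` (the shape in which (T3) `LevLowEqSqAt` asks it: `levFixCount σ ϖ (d % 2) (mstarOfRecord d) (Γ b)`).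
[cite: Kottwitz1986BaseChangeUnits, §1 pp. 240–241] -/
theorem ncard_levels_mod_two_eq_ncard_sqLevel_of_even (σ : K →+* K) (ϖ : K) {d : ℕ} (hd : d % 2 = 0) (b : ℕ) (T : GL (Fin 3) K) :
    {M : Submodule 𝒪[K] (Fin 3 → K) | IsVertexLattice σ ϖ ((StdForm.antidiagonal 3).over K) 0 M ∧ mapGL T M = M ∧
        (LatticeInLevel ϖ (d % 2) ((T : Matrix (Fin 3) (Fin 3) K) - 1) M ∧
          LatticeInLevel ϖ b (((T : Matrix (Fin 3) (Fin 3) K) - 1) * ((T : Matrix (Fin 3) (Fin 3) K) - 1)) M)}.ncard =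
      {M : Submodule 𝒪[K] (Fin 3 → K) | IsVertexLattice σ ϖ ((StdForm.antidiagonal 3).over K) 0 M ∧ mapGL T M = M ∧
        LatticeInLevel ϖ b (((T : Matrix (Fin 3) (Fin 3) K) - 1) * ((T : Matrix (Fin 3) (Fin 3) K) - 1)) M}.ncard := by
  rw [hd]
  exact ncard_levels_zero_eq_ncard_sqLevel σ ϖ b T

end Summit.HodgeConjecture.HodgeConjecture.Cruxes.H413.F0P3cDyRamLevelsZeroEqSqLevel
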